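import Literature.NumberTheory.Transcendental.RoySmallValueStep2Distances
import Literature.NumberTheory.Transcendental.RoySmallValueDistance
import HarnessLib

/-!
# Roy's small value estimate for `𝔾ₐ × 𝔾ₘ` — the selected orbit lies in the chart `𝒢 = {x₀x₂ ≠ 0}`

Topic `Literature/NumberTheory/Transcendental`. Part of the formalisation of the proof of Roy 2013,
Theorem 1.1 (named fact `roy2013_thm_1_1`, `RoySmallValueEstimates.lean`), seat B. Source: D. Roy,
*A small value estimate for `𝔾ₐ × 𝔾ₘ`*, Mathematika 59 (2013) 333–363 = arXiv:1301.0663, §3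
(`𝒢 = ℙ²(ℂ) ∖ {x₀x₂ = 0}`, p. 8), §6 (proof of Prop. 6.4: "`Z(ℂ) ⊆ 𝒢`, because otherwise, `Z` being
irreducible over `ℚ`, we would have `Z(ℂ) = {(0:1:0)}` or `{(0:0:1)}`") and §7, Step 2 (p. 18):

> In particular, the set `𝒰` is not empty and contains at least one point `α₀` for which
> `log dist(α₀,(1:γ)) ≤ −D^{δ+β}/(25T)`.

The multiplicity estimate at a point `α` of the selected orbit `O` (Prop. 3.6 / Cor. 5.7, the
tree's `le_mult_of_mem_vanIdeal`) needs `α ∈ 𝒢`, i.e. `α₀α₂ ≠ 0`. This file derives it for ALL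
points of `O` from the existence of ONE point of `O` close to `(1 : ξ : η)` (`η ≠ 0`):

* `chart_of_pdist_lt` — a sup-normalised `u` with `dist(u,(1:γ)) ≤ (2c₂)⁻¹` and
  `dist(u,(1:γ)) < |η|/(2c₂²)` has `u₀ ≠ 0` and `u₂ ≠ 0` (Lemma 4.1 for `u₀`; `|u₂ − u₀η| ≤ c₂ dist`);
* `ZeroConfigK.apply_eq_zero_iff_of_mem_orb` — the zero pattern of the coordinates is constant along
  an orbit (the points of an orbit are the conjugates `g·rep` computed EXACTLY);
* `ZeroConfigK.chart_of_mem_orb` — hence `α_j 0 ≠ 0`, `α_j 2 ≠ 0` for every `j ∈ O` as soon as one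
  sup-normalised point of `O` is that close to `(1:γ)`.
* `ZeroConfigK.chart_supNormalise_of_mem_orb` — the same for the sup-normalised representatives `u_j`.

Everything is proved; no definitions, no named facts.

## References

* [Roy2013] D. Roy, *A small value estimate for 𝔾ₐ × 𝔾ₘ*, Mathematika 59 (2013), 333–363
  (arXiv:1301.0663), §3 (the set `𝒢`), §6 (proof of Prop. 6.4), §7 Step 2, Lemma 4.1.
-/

noncomputable section

open MvPolynomial Finset

namespace Literature.NumberTheory.Transcendental

namespace Roy2013

/-- **A sup-normalised point close to `(1:γ)` lies in the chart `x₀x₂ ≠ 0`.**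
[cite: Roy2013, Lemma 4.1 and §3 (the set `𝒢`)] -/
theorem chart_of_pdist_lt {ξ η : ℂ} (hη : η ≠ 0) {u : Fin 3 → ℂ} (hu1 : ∃ i, 1 ≤ ‖u i‖)
    (hd : pdist ξ η u ≤ (2 * roy_c2 ξ η)⁻¹) (hd2 : pdist ξ η u < ‖η‖ / (2 * roy_c2 ξ η ^ 2)) :
    u 0 ≠ 0 ∧ u 2 ≠ 0 := by
  have hc := one_le_roy_c2 ξ η
  have hc0 : 0 < roy_c2 ξ η := by linarith
  have hu0 : (2 * roy_c2 ξ η)⁻¹ ≤ ‖u 0‖ := lemma_4_1 hu1 hd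
  have hρ : 0 < (2 * roy_c2 ξ η)⁻¹ := by positivity
  refine ⟨fun h0 => ?_, fun h2 => ?_⟩
  · rw [h0, norm_zero] at hu0; linarith
  · -- `|u₂ − u₀η| ≤ c₂ dist`, so `|u₀| |η| ≤ c₂ dist < |η|/(2c₂)`, contradicting `|u₀| ≥ (2c₂)⁻¹`
    have h1 := norm_sub_eta_le_pdist ξ η u
    rw [h2, zero_sub, norm_neg, norm_mul] at h1
    have h3 : ‖u 0‖ * ‖η‖ < ‖η‖ / (2 * roy_c2 ξ η) := by
      calc ‖u 0‖ * ‖η‖ ≤ roy_c2 ξ η * pdist ξ η u := h1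
        _ < roy_c2 ξ η * (‖η‖ / (2 * roy_c2 ξ η ^ 2)) := mul_lt_mul_of_pos_left hd2 hc0
        _ = ‖η‖ / (2 * roy_c2 ξ η) := by field_simp
    have hη0 : 0 < ‖η‖ := norm_pos_iff.mpr hη
    have h4 : (2 * roy_c2 ξ η)⁻¹ * ‖η‖ ≤ ‖u 0‖ * ‖η‖ := mul_le_mul_of_nonneg_right hu0 hη0.le
    rw [div_eq_mul_inv, mul_comm ‖η‖] at h3
    linarith

/-- Sup-normalisation does not change the zero pattern. [folklore] -/
theorem supNormalise_apply_eq_zero_iff {α : Fin 3 → ℂ} (hα : α ≠ 0) (k : Fin 3) :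
    supNormalise α k = 0 ↔ α k = 0 := by
  rw [supNormalise, Pi.smul_apply, smul_eq_zero]
  have : ((‖α‖⁻¹ : ℝ) : ℂ) ≠ 0 := by
    exact_mod_cast inv_ne_zero (norm_ne_zero_iff.mpr hα)
  exact ⟨fun h => h.resolve_left this, fun h => Or.inr h⟩

namespace ZeroConfigK

variable {K : IntermediateField ℚ ℂ} {ι : Type*} [Fintype ι] [DecidableEq ι] (Z : ZeroConfigK K ι)
  [NumberField K]

/-- **The zero pattern of the coordinates is constant along an orbit.** [cite: Roy2013, §6, proof of Prop. 6.4 ("`Z` being irreducible over `ℚ` …")] -/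
theorem apply_eq_zero_iff_of_mem_orb {i j : ι} (hj : j ∈ Z.orb i) (k : Fin 3) :
    Z.α j k = 0 ↔ Z.α i k = 0 := by
  obtain ⟨-, g, rfl⟩ := mem_filter.mp hj
  have h1 : Z.α (Z.perm g i) k = (((g (Z.rep i k) : K)) : ℂ) := by
    have := congrFun (Z.rep_perm g i) k
    -- `rep (perm g i) k = g (rep i k)` in `K`; take complex values
    have h2 : ((Z.rep (Z.perm g i) k : K) : ℂ) = Z.α (Z.perm g i) k := Z.coe_rep _ _
    rw [← h2, ← this]
  rw [h1]
  constructor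
  · intro h
    have h3 : g (Z.rep i k) = 0 := by exact_mod_cast h
    have h4 : Z.rep i k = 0 := by
      have := congrArg g.symm h3
      rwa [map_zero, AlgEquiv.symm_apply_apply] at this
    have := congrArg (fun x : K => (x : ℂ)) h4
    simpa [Z.coe_rep] using this
  · intro h
    have h4 : Z.rep i k = 0 := by
      apply Subtype.ext
      change Z.α i k = 0
      exact h
    rw [h4, map_zero]; rfl

/-- **Every point of the orbit lies in `𝒢`** as soon as one sup-normalised point of it is close to
`(1:γ)`. [cite: Roy2013, §6 (proof of Prop. 6.4, `Z(ℂ) ⊆ 𝒢`) and §7 Step 2 (the point `α₀`)] -/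
theorem chart_of_mem_orb {ξ η : ℂ} (hη : η ≠ 0) {i₀ j₀ : ι} (hj₀ : j₀ ∈ Z.orb i₀)
    (hd : pdist ξ η (supNormalise (Z.α j₀)) ≤ (2 * roy_c2 ξ η)⁻¹)
    (hd2 : pdist ξ η (supNormalise (Z.α j₀)) < ‖η‖ / (2 * roy_c2 ξ η ^ 2)) :
    ∀ j ∈ Z.orb i₀, Z.α j 0 ≠ 0 ∧ Z.α j 2 ≠ 0 := by
  have hu := chart_of_pdist_lt hη (exists_one_le_supNormalise (Z.α_ne_zero j₀)) hd hd2
  have h0 : Z.α j₀ 0 ≠ 0 := fun h => hu.1 ((supNormalise_apply_eq_zero_iff (Z.α_ne_zero j₀) 0).mpr h)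
  have h2 : Z.α j₀ 2 ≠ 0 := fun h => hu.2 ((supNormalise_apply_eq_zero_iff (Z.α_ne_zero j₀) 2).mpr h)
  intro j hj
  have e0 := (Z.apply_eq_zero_iff_of_mem_orb hj 0).not
  have e2 := (Z.apply_eq_zero_iff_of_mem_orb hj 2).not
  have f0 := (Z.apply_eq_zero_iff_of_mem_orb hj₀ 0).not
  have f2 := (Z.apply_eq_zero_iff_of_mem_orb hj₀ 2).not
  exact ⟨e0.mpr (f0.mp h0), e2.mpr (f2.mp h2)⟩

/-- **Every sup-normalised point `u_j` of the orbit lies in `𝒢`** under the same hypotheses: the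
representatives of norm `1`, with which the distances are computed, have `u_{j,0} ≠ 0` and
`u_{j,2} ≠ 0`. [cite: Roy2013, §6 (proof of Prop. 6.4, `Z(ℂ) ⊆ 𝒢`) and §7 Step 2 (the point `α₀`)] -/
theorem chart_supNormalise_of_mem_orb {ξ η : ℂ} (hη : η ≠ 0) {i₀ j₀ : ι} (hj₀ : j₀ ∈ Z.orb i₀)
    (hd : pdist ξ η (supNormalise (Z.α j₀)) ≤ (2 * roy_c2 ξ η)⁻¹)
    (hd2 : pdist ξ η (supNormalise (Z.α j₀)) < ‖η‖ / (2 * roy_c2 ξ η ^ 2)) :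
    ∀ j ∈ Z.orb i₀, supNormalise (Z.α j) 0 ≠ 0 ∧ supNormalise (Z.α j) 2 ≠ 0 := fun j hj =>
  ⟨fun h => (Z.chart_of_mem_orb hη hj₀ hd hd2 j hj).1
      ((supNormalise_apply_eq_zero_iff (Z.α_ne_zero j) 0).mp h),
    fun h => (Z.chart_of_mem_orb hη hj₀ hd hd2 j hj).2
      ((supNormalise_apply_eq_zero_iff (Z.α_ne_zero j) 2).mp h)⟩

end ZeroConfigK

end Roy2013

end Literature.NumberTheory.Transcendental
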